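import Literature.NumberTheory.LFunctions.WeilMarkovQuadratic
import Mathlib.Analysis.SpecialFunctions.Sqrt
import HarnessLib

/-!
# RiemannHypothesis / GroundBarta — crux `PolarPerronFrobenius` (stmt-RiemannHypothesis-18390):
# smooth non-negative approximants `ψ_η ∘ f` of `|f|` (small-window Perron–Frobenius, part 1/3)

Helper file (`--supports`), RH-free, Mathlib + proved tree files only, no definitions.

For a real-valued smooth compactly supported `f` and `η > 0` the function
`w_η = ψ_η ∘ f`, `ψ_η(x) = √(x² + η²) − η`, is smooth, non-negative, has the same support as `f`,
satisfies `|f| − η ≤ w_η ≤ |f|`, is even when `f` is even, and `ψ_η` is a `1`-Lipschitz normal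
contraction (`ψ_η(0) = 0`).  Hence (Beurling–Deny / Chen–Fukushima: normal contractions operate on
the increment form, `weilIncrement_comp_le` in the tree) `D_t(w_η) ≤ D_t(f)` for every `t`, and as
`η → 0⁺` every pairing `∫ w_η φ` (with a continuous weight `φ`) and the `L²`-mass `∫ w_η²` converge
to the corresponding quantities of `|f|`, with explicit rate `O(η)`.

These are the test-level substitutes for `|f|` (which is only Lipschitz) in the sign-improving
inequality of the companion file `GroundBartaPolarPerronFrobeniusSignImproving.lean`.
Prover B, speedrun unit `sr-gb-rung-b` (rung 3, small-window Perron–Frobenius).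
-/

set_option linter.dupNamespace false

noncomputable section

open Set MeasureTheory Filter Complex
open scoped Real Topology

namespace Summit.RiemannHypothesis.RiemannHypothesis.Theorems.PolarPerronFrobenius

open Literature.NumberTheory.LFunctions

/-! ## The smooth absolute value `ψ_η(x) = √(x² + η²) − η` -/

section Psi

variable {η : ℝ}

/-- `ψ_η(x) + η = ‖x + ηi‖`. [folklore] -/
theorem sw_sqrt_sq_add_sq_eq_norm (x η : ℝ) :
    Real.sqrt (x ^ 2 + η ^ 2) = ‖(x : ℂ) + (η : ℂ) * I‖ :=
  (Complex.norm_add_mul_I x η).symm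

/-- `ψ_η ≥ 0` for `η ≥ 0`. [folklore] -/
theorem sw_psi_nonneg (hη : 0 ≤ η) (x : ℝ) : 0 ≤ Real.sqrt (x ^ 2 + η ^ 2) - η := by
  have h : Real.sqrt (η ^ 2) ≤ Real.sqrt (x ^ 2 + η ^ 2) :=
    Real.sqrt_le_sqrt (by nlinarith [sq_nonneg x])
  rw [Real.sqrt_sq hη] at h
  linarith

/-- `ψ_η(x) ≤ |x|` for `η ≥ 0`. [folklore] -/
theorem sw_psi_le_abs (hη : 0 ≤ η) (x : ℝ) : Real.sqrt (x ^ 2 + η ^ 2) - η ≤ |x| := by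
  have h : Real.sqrt (x ^ 2 + η ^ 2) ≤ Real.sqrt ((|x| + η) ^ 2) :=
    Real.sqrt_le_sqrt (by nlinarith [sq_abs x, abs_nonneg x])
  rw [Real.sqrt_sq (by positivity)] at h
  linarith

/-- `|x| − η ≤ ψ_η(x)`. [folklore] -/
theorem sw_abs_sub_le_psi (x η : ℝ) : |x| - η ≤ Real.sqrt (x ^ 2 + η ^ 2) - η := by
  have h : Real.sqrt (x ^ 2) ≤ Real.sqrt (x ^ 2 + η ^ 2) :=
    Real.sqrt_le_sqrt (by nlinarith [sq_nonneg η])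
  rw [Real.sqrt_sq_eq_abs] at h
  linarith

/-- `|ψ_η(x) − |x|| ≤ η` for `η ≥ 0`. [folklore] -/
theorem sw_abs_psi_sub_abs_le (hη : 0 ≤ η) (x : ℝ) :
    abs ((Real.sqrt (x ^ 2 + η ^ 2) - η) - |x|) ≤ η := by
  rw [abs_le]
  constructor
  · linarith [sw_abs_sub_le_psi x η]
  · linarith [sw_psi_le_abs hη x]

/-- `ψ_η(0) = 0` for `η ≥ 0`. [folklore] -/
theorem sw_psi_zero (hη : 0 ≤ η) : Real.sqrt ((0 : ℝ) ^ 2 + η ^ 2) - η = 0 := by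
  rw [zero_pow two_ne_zero, zero_add, Real.sqrt_sq hη, sub_self]

/-- `ψ_η(x) = 0` forces `x = 0` (for `η ≥ 0`). [folklore] -/
theorem sw_eq_zero_of_psi_eq_zero {x : ℝ}
    (h : Real.sqrt (x ^ 2 + η ^ 2) - η = 0) : x = 0 := by
  have h1 : Real.sqrt (x ^ 2 + η ^ 2) = η := by linarith
  have h2 : x ^ 2 + η ^ 2 = η ^ 2 := by
    have := Real.sq_sqrt (by positivity : (0 : ℝ) ≤ x ^ 2 + η ^ 2)
    rw [h1] at this
    linarith
  exact pow_eq_zero_iff (n := 2) two_ne_zero |>.1 (by linarith)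

/-- `ψ_η` is `1`-Lipschitz: `|ψ_η(x) − ψ_η(y)| ≤ |x − y|` (reverse triangle inequality for the
Euclidean norm of `(x, η)`). [folklore] -/
theorem sw_abs_psi_sub_psi_le (x y η : ℝ) :
    |(Real.sqrt (x ^ 2 + η ^ 2) - η) - (Real.sqrt (y ^ 2 + η ^ 2) - η)| ≤ |x - y| := by
  rw [sw_sqrt_sq_add_sq_eq_norm, sw_sqrt_sq_add_sq_eq_norm]
  have h := abs_norm_sub_norm_le ((x : ℂ) + (η : ℂ) * I) ((y : ℂ) + (η : ℂ) * I)
  have e : (x : ℂ) + (η : ℂ) * I - ((y : ℂ) + (η : ℂ) * I) = ((x - y : ℝ) : ℂ) := by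
    push_cast
    ring
  rw [e, Complex.norm_real, Real.norm_eq_abs] at h
  simpa only [sub_sub_sub_cancel_right] using h

/-- The complex extension `z ↦ ψ_η(Re z)` is a `1`-Lipschitz map of `ℂ`. [folklore] -/
theorem sw_lipschitz_psi_re (η : ℝ) :
    LipschitzWith 1 (fun z : ℂ => ((Real.sqrt (z.re ^ 2 + η ^ 2) - η : ℝ) : ℂ)) := by
  refine LipschitzWith.of_dist_le_mul fun z w => ?_
  simp only [NNReal.coe_one, one_mul, Complex.dist_eq, ← Complex.ofReal_sub, Complex.norm_real,
    Real.norm_eq_abs]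
  calc |Real.sqrt (z.re ^ 2 + η ^ 2) - η - (Real.sqrt (w.re ^ 2 + η ^ 2) - η)|
      ≤ |z.re - w.re| := sw_abs_psi_sub_psi_le _ _ _
    _ = |(z - w).re| := by rw [Complex.sub_re]
    _ ≤ ‖z - w‖ := Complex.abs_re_le_norm _

/-- `ψ_η` is smooth for `η ≠ 0`. [folklore] -/
theorem sw_contDiff_psi (hη : η ≠ 0) :
    ContDiff ℝ (⊤ : ℕ∞) (fun x : ℝ => Real.sqrt (x ^ 2 + η ^ 2) - η) := by
  refine ContDiff.sub (ContDiff.sqrt ((contDiff_id.pow 2).add contDiff_const) fun x => ?_)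
    contDiff_const
  have : 0 < η ^ 2 := by positivity
  positivity

end Psi

/-! ## The approximants `w_η = ψ_η ∘ f` of `|f|` as test functions -/

section Approximants

variable {f : ℝ → ℝ} {η a : ℝ}

/-- `w_η = ψ_η ∘ f` (cast to `ℂ`) is a Weil test function when `f` is smooth with compact support
and `η > 0`. [folklore] -/
theorem sw_isWeilTest_psi_comp (hf : ContDiff ℝ (⊤ : ℕ∞) f) (hfs : HasCompactSupport f)
    (hη : 0 < η) :
    IsWeilTest fun t => ((Real.sqrt (f t ^ 2 + η ^ 2) - η : ℝ) : ℂ) := by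
  refine ⟨Complex.ofRealCLM.contDiff.comp ((sw_contDiff_psi hη.ne').comp hf), ?_⟩
  refine HasCompactSupport.comp_left (g := Complex.ofReal) ?_ Complex.ofReal_zero
  refine hfs.mono fun t ht => ?_
  rw [Function.mem_support] at ht ⊢
  intro h0
  apply ht
  rw [h0]
  exact sw_psi_zero hη.le

/-- The support of `w_η` is contained in the support of `f`. [folklore] -/
theorem sw_support_psi_comp_subset (hη : 0 ≤ η) :
    Function.support (fun t => ((Real.sqrt (f t ^ 2 + η ^ 2) - η : ℝ) : ℂ)) ⊆
      Function.support f := by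
  intro t ht
  rw [Function.mem_support] at ht ⊢
  intro h0
  apply ht
  rw [h0, sw_psi_zero hη, Complex.ofReal_zero]

/-- `tsupport w_η ⊆ tsupport f`. [folklore] -/
theorem sw_tsupport_psi_comp_subset (hη : 0 ≤ η) :
    tsupport (fun t => ((Real.sqrt (f t ^ 2 + η ^ 2) - η : ℝ) : ℂ)) ⊆ tsupport f :=
  closure_mono (sw_support_psi_comp_subset hη)

/-- `tsupport (f : ℂ) = tsupport f` for the complexification of a real function. [folklore] -/
theorem sw_tsupport_ofReal_comp (f : ℝ → ℝ) :
    tsupport (fun t => ((f t : ℝ) : ℂ)) = tsupport f := by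
  unfold tsupport
  congr 1
  ext t
  simp only [Function.mem_support, ne_eq, Complex.ofReal_eq_zero]

/-- The complexification of a real smooth compactly supported function is a Weil test. [folklore] -/
theorem sw_isWeilTest_ofReal_comp (hf : ContDiff ℝ (⊤ : ℕ∞) f) (hfs : HasCompactSupport f) :
    IsWeilTest fun t => ((f t : ℝ) : ℂ) :=
  ⟨Complex.ofRealCLM.contDiff.comp hf, hfs.comp_left (g := Complex.ofReal) Complex.ofReal_zero⟩

/-- `w_η` is real and non-negative pointwise. [folklore] -/
theorem sw_psi_comp_im_re (hη : 0 ≤ η) (t : ℝ) :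
    (((Real.sqrt (f t ^ 2 + η ^ 2) - η : ℝ) : ℂ)).im = 0 ∧
      0 ≤ (((Real.sqrt (f t ^ 2 + η ^ 2) - η : ℝ) : ℂ)).re := by
  rw [Complex.ofReal_im, Complex.ofReal_re]
  exact ⟨rfl, sw_psi_nonneg hη _⟩

/-- `w_η` is even when `f` is even. [folklore] -/
theorem sw_psi_comp_even (hfe : ∀ t, f (-t) = f t) (t : ℝ) :
    ((Real.sqrt (f (-t) ^ 2 + η ^ 2) - η : ℝ) : ℂ) = ((Real.sqrt (f t ^ 2 + η ^ 2) - η : ℝ) : ℂ) := by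
  rw [hfe]

/-- **Contraction of increments**: `D_t(w_η) ≤ D_t(f)` for every `t` (normal contractions operate
on the increment form; `weilIncrement_comp_le`). [cite: ChenFukushima2012, §1.1 Thm. 1.1.3(e)] -/
theorem sw_weilIncrement_psi_comp_le (hf : ContDiff ℝ (⊤ : ℕ∞) f) (hfs : HasCompactSupport f)
    (η t : ℝ) :
    weilIncrement (fun x => ((Real.sqrt (f x ^ 2 + η ^ 2) - η : ℝ) : ℂ)) t ≤
      weilIncrement (fun x => ((f x : ℝ) : ℂ)) t := by
  have hF : IsWeilTest fun x => ((f x : ℝ) : ℂ) := sw_isWeilTest_ofReal_comp hf hfs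
  have hcomp : (fun z : ℂ => ((Real.sqrt (z.re ^ 2 + η ^ 2) - η : ℝ) : ℂ)) ∘
      (fun x => ((f x : ℝ) : ℂ)) = fun x => ((Real.sqrt (f x ^ 2 + η ^ 2) - η : ℝ) : ℂ) := by
    funext x
    simp only [Function.comp_apply, Complex.ofReal_re]
  rw [← hcomp]
  exact weilIncrement_comp_le (sw_lipschitz_psi_re η)
    (integrable_weilIncrement_integrand hF.memLp_two t)

/-- `‖w_η‖² ≤ ‖f‖²` pointwise, hence `∫ ‖w_η‖² ≤ ∫ ‖f‖²`. [folklore] -/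
theorem sw_integral_norm_sq_psi_comp_le (hf : ContDiff ℝ (⊤ : ℕ∞) f) (hfs : HasCompactSupport f)
    (hη : 0 ≤ η) :
    ∫ t, ‖((Real.sqrt (f t ^ 2 + η ^ 2) - η : ℝ) : ℂ)‖ ^ 2 ≤ ∫ t, ‖((f t : ℝ) : ℂ)‖ ^ 2 := by
  have hF : IsWeilTest fun x => ((f x : ℝ) : ℂ) := sw_isWeilTest_ofReal_comp hf hfs
  refine integral_mono_of_nonneg (Eventually.of_forall fun t => by positivity) hF.integrable_norm_sq
    (Eventually.of_forall fun t => ?_)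
  simp only [Complex.norm_real, Real.norm_eq_abs, sq_abs]
  have h0 := sw_psi_nonneg hη (f t)
  have h1 := sw_psi_le_abs hη (f t)
  calc (Real.sqrt (f t ^ 2 + η ^ 2) - η) ^ 2 ≤ |f t| ^ 2 := pow_le_pow_left₀ h0 h1 2
    _ = f t ^ 2 := sq_abs _

end Approximants

/-! ## Convergence `w_η → |f|` against weights, with rate `O(η)` -/

section Limits

variable {f : ℝ → ℝ} {a : ℝ}

/-- A limit criterion: `‖X η − L‖ ≤ K η` for `η > 0` gives `X → L` as `η → 0⁺`. [folklore] -/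
theorem sw_tendsto_of_norm_sub_le {E : Type*} [SeminormedAddCommGroup E] {X : ℝ → E} {L : E}
    {K : ℝ} (h : ∀ η : ℝ, 0 < η → ‖X η - L‖ ≤ K * η) :
    Tendsto X (𝓝[>] 0) (𝓝 L) := by
  rw [Metric.tendsto_nhdsWithin_nhds]
  intro ε hε
  refine ⟨ε / (|K| + 1), by positivity, fun η hη hdist => ?_⟩
  have hη0 : 0 < η := hη
  rw [dist_eq_norm, sub_zero, Real.norm_eq_abs, abs_of_pos hη0] at hdist
  rw [dist_eq_norm]
  calc ‖X η - L‖ ≤ K * η := h η hη0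
    _ ≤ (|K| + 1) * η := by nlinarith [le_abs_self K]
    _ < (|K| + 1) * (ε / (|K| + 1)) := by gcongr
    _ = ε := by field_simp

/-- **Pairings converge**: for a continuous weight `φ`, a real continuous `f` supported in
`[-a, a]` and `η > 0`,
`‖∫ w_η φ − ∫ |f| φ‖ ≤ η ∫_{[-a,a]} ‖φ‖`. [folklore] -/
theorem sw_norm_integral_psi_sub_abs_mul_le (hfc : Continuous f) (hsupp : Function.support f ⊆ Icc (-a) a)
    {φ : ℝ → ℂ} (hφ : Continuous φ) {η : ℝ} (hη : 0 ≤ η) :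
    ‖(∫ t, ((Real.sqrt (f t ^ 2 + η ^ 2) - η : ℝ) : ℂ) * φ t) - ∫ t, ((|f t| : ℝ) : ℂ) * φ t‖ ≤
      η * ∫ t in Icc (-a) a, ‖φ t‖ := by
  -- both pairings are integrals of continuous functions supported in `[-a, a]`
  have hK : IsCompact (Icc (-a) a) := isCompact_Icc
  have hsuppψ : Function.support (fun t => ((Real.sqrt (f t ^ 2 + η ^ 2) - η : ℝ) : ℂ) * φ t) ⊆
      Icc (-a) a := by
    intro t ht
    apply hsupp
    rw [Function.mem_support] at ht ⊢
    intro h0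
    apply ht
    rw [h0, sw_psi_zero hη, Complex.ofReal_zero, zero_mul]
  have hsuppa : Function.support (fun t => ((|f t| : ℝ) : ℂ) * φ t) ⊆ Icc (-a) a := by
    intro t ht
    apply hsupp
    rw [Function.mem_support] at ht ⊢
    intro h0
    apply ht
    rw [h0, abs_zero, Complex.ofReal_zero, zero_mul]
  have hcψ : Continuous fun t => ((Real.sqrt (f t ^ 2 + η ^ 2) - η : ℝ) : ℂ) * φ t :=
    (Complex.continuous_ofReal.comp (((hfc.pow 2).add continuous_const).sqrt.sub
      continuous_const)).mul hφ
  have hca : Continuous fun t => ((|f t| : ℝ) : ℂ) * φ t :=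
    (Complex.continuous_ofReal.comp hfc.abs).mul hφ
  have hiψ : Integrable fun t => ((Real.sqrt (f t ^ 2 + η ^ 2) - η : ℝ) : ℂ) * φ t :=
    hcψ.integrable_of_hasCompactSupport (HasCompactSupport.of_support_subset_isCompact hK hsuppψ)
  have hia : Integrable fun t => ((|f t| : ℝ) : ℂ) * φ t :=
    hca.integrable_of_hasCompactSupport (HasCompactSupport.of_support_subset_isCompact hK hsuppa)
  rw [← integral_sub hiψ hia]
  -- pointwise bound by `η ‖φ‖ 𝟙_{[-a,a]}`
  have hbound : ∀ t, ‖((Real.sqrt (f t ^ 2 + η ^ 2) - η : ℝ) : ℂ) * φ t - ((|f t| : ℝ) : ℂ) * φ t‖ ≤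
      (Icc (-a) a).indicator (fun t => η * ‖φ t‖) t := by
    intro t
    by_cases ht : t ∈ Icc (-a) a
    · rw [indicator_of_mem ht, ← sub_mul, norm_mul, ← Complex.ofReal_sub, Complex.norm_real,
        Real.norm_eq_abs]
      exact mul_le_mul_of_nonneg_right (sw_abs_psi_sub_abs_le hη _) (norm_nonneg _)
    · rw [indicator_of_notMem ht]
      have hf0 : f t = 0 := by
        by_contra h
        exact ht (hsupp (Function.mem_support.2 h))
      rw [hf0, sw_psi_zero hη, abs_zero, sub_self, norm_zero]
  have hint : Integrable fun t => (Icc (-a) a).indicator (fun t => η * ‖φ t‖) t := by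
    refine (integrable_indicator_iff measurableSet_Icc).2 ?_
    exact ((continuous_const.mul hφ.norm).continuousOn.integrableOn_compact hK)
  calc ‖∫ t, (((Real.sqrt (f t ^ 2 + η ^ 2) - η : ℝ) : ℂ) * φ t - ((|f t| : ℝ) : ℂ) * φ t)‖
      ≤ ∫ t, (Icc (-a) a).indicator (fun t => η * ‖φ t‖) t :=
        norm_integral_le_of_norm_le hint (Eventually.of_forall hbound)
    _ = η * ∫ t in Icc (-a) a, ‖φ t‖ := by
        rw [integral_indicator measurableSet_Icc, integral_const_mul]

/-- **Pairings converge** (filter form): `∫ w_η φ → ∫ |f| φ` as `η → 0⁺`. [folklore] -/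
theorem sw_tendsto_integral_psi_mul (hfc : Continuous f) (hsupp : Function.support f ⊆ Icc (-a) a)
    {φ : ℝ → ℂ} (hφ : Continuous φ) :
    Tendsto (fun η : ℝ => ∫ t, ((Real.sqrt (f t ^ 2 + η ^ 2) - η : ℝ) : ℂ) * φ t) (𝓝[>] 0)
      (𝓝 (∫ t, ((|f t| : ℝ) : ℂ) * φ t)) :=
  sw_tendsto_of_norm_sub_le fun η hη => by
    rw [mul_comm]
    exact sw_norm_integral_psi_sub_abs_mul_le hfc hsupp hφ hη.le

/-- **Masses converge**: `|∫ w_η² − ∫ f²| ≤ 2η ∫ |f|` (`|w_η² − f²| = (|f| − w_η)(|f| + w_η) ≤ 2η|f|`). [folklore] -/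
theorem sw_abs_integral_norm_sq_psi_sub_le (hfc : Continuous f) (hfs : HasCompactSupport f)
    {η : ℝ} (hη : 0 ≤ η) :
    |(∫ t, ‖((Real.sqrt (f t ^ 2 + η ^ 2) - η : ℝ) : ℂ)‖ ^ 2) - ∫ t, ‖((f t : ℝ) : ℂ)‖ ^ 2| ≤
      (2 * ∫ t, |f t|) * η := by
  have hcψ : Continuous fun t => Real.sqrt (f t ^ 2 + η ^ 2) - η :=
    ((hfc.pow 2).add continuous_const).sqrt.sub continuous_const
  have hψs : HasCompactSupport fun t => Real.sqrt (f t ^ 2 + η ^ 2) - η := by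
    refine hfs.mono fun t ht => ?_
    rw [Function.mem_support] at ht ⊢
    intro h0
    apply ht
    rw [h0]
    exact sw_psi_zero hη
  have hi1 : Integrable fun t => ‖((Real.sqrt (f t ^ 2 + η ^ 2) - η : ℝ) : ℂ)‖ ^ 2 := by
    have : Continuous fun t => ‖((Real.sqrt (f t ^ 2 + η ^ 2) - η : ℝ) : ℂ)‖ ^ 2 :=
      (Complex.continuous_ofReal.comp hcψ).norm.pow 2
    refine this.integrable_of_hasCompactSupport ?_
    exact (hψs.comp_left (g := Complex.ofReal) Complex.ofReal_zero).norm.comp_left (g := (· ^ 2))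
      (zero_pow two_ne_zero)
  have hi2 : Integrable fun t => ‖((f t : ℝ) : ℂ)‖ ^ 2 := by
    have : Continuous fun t => ‖((f t : ℝ) : ℂ)‖ ^ 2 := (Complex.continuous_ofReal.comp hfc).norm.pow 2
    refine this.integrable_of_hasCompactSupport ?_
    exact (hfs.comp_left (g := Complex.ofReal) Complex.ofReal_zero).norm.comp_left (g := (· ^ 2))
      (zero_pow two_ne_zero)
  have hi3 : Integrable fun t => |f t| := (hfc.integrable_of_hasCompactSupport hfs).abs
  rw [← integral_sub hi1 hi2]
  calc |∫ t, (‖((Real.sqrt (f t ^ 2 + η ^ 2) - η : ℝ) : ℂ)‖ ^ 2 - ‖((f t : ℝ) : ℂ)‖ ^ 2)|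
      ≤ ∫ t, |‖((Real.sqrt (f t ^ 2 + η ^ 2) - η : ℝ) : ℂ)‖ ^ 2 - ‖((f t : ℝ) : ℂ)‖ ^ 2| :=
        abs_integral_le_integral_abs
    _ ≤ ∫ t, 2 * η * |f t| := by
        refine integral_mono_of_nonneg (Eventually.of_forall fun t => abs_nonneg _)
          (hi3.const_mul (2 * η)) (Eventually.of_forall fun t => ?_)
        simp only [Complex.norm_real, Real.norm_eq_abs, sq_abs]
        have h0 := sw_psi_nonneg hη (f t)
        have h1 := sw_psi_le_abs hη (f t)
        have h2 := sw_abs_sub_le_psi (f t) η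
        have hsq : f t ^ 2 = |f t| ^ 2 := (sq_abs _).symm
        generalize Real.sqrt (f t ^ 2 + η ^ 2) - η = y at h0 h1 h2 ⊢
        have hfa := abs_nonneg (f t)
        have hle : y ^ 2 ≤ f t ^ 2 := by rw [hsq]; exact pow_le_pow_left₀ h0 h1 2
        rw [abs_sub_comm, abs_of_nonneg (by linarith)]
        calc f t ^ 2 - y ^ 2 = (|f t| - y) * (|f t| + y) := by rw [hsq]; ring
          _ ≤ η * (|f t| + y) := mul_le_mul_of_nonneg_right (by linarith) (by linarith)
          _ ≤ η * (2 * |f t|) := mul_le_mul_of_nonneg_left (by linarith) hη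
          _ = 2 * η * |f t| := by ring
    _ = (2 * ∫ t, |f t|) * η := by
        rw [integral_const_mul]
        ring

/-- **Masses converge** (filter form): `∫ ‖w_η‖² → ∫ ‖f‖²` as `η → 0⁺`. [folklore] -/
theorem sw_tendsto_integral_norm_sq_psi (hfc : Continuous f) (hfs : HasCompactSupport f) :
    Tendsto (fun η : ℝ => ∫ t, ‖((Real.sqrt (f t ^ 2 + η ^ 2) - η : ℝ) : ℂ)‖ ^ 2) (𝓝[>] 0)
      (𝓝 (∫ t, ‖((f t : ℝ) : ℂ)‖ ^ 2)) :=
  sw_tendsto_of_norm_sub_le fun η hη => by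
    rw [Real.norm_eq_abs]
    exact sw_abs_integral_norm_sq_psi_sub_le hfc hfs hη.le

end Limits

end Summit.RiemannHypothesis.RiemannHypothesis.Theorems.PolarPerronFrobenius

end
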